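import Mathlib
import Summits.ResolutionOfSingularities.ResolutionOfSingularities.Theorems.PAlterationPicoverLocalModelSingularLocus

/-!
# Sketch — first lemmas of the crux ideas for stmt-ResolutionOfSingularities-0557 (`PicoverLocalModel`)

Ideator 3, round 1. Statements only need to ELABORATE (sorries allowed here; this file is not proposed).
-/

open Polynomial

namespace Summit.ResolutionOfSingularities.ResolutionOfSingularities.Cruxes.PicoverLocalModel.SketchIdeator3

/-! ## Card `giraud-normal-form` — first lemma: the Kummer twist inside the Frobenius class

If `a = x^m · u` with `u` a unit and `p ∤ m`, pick Bézout coefficients `α p + β m = 1`; then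
`t ↦ s^m · u^α` is an `R`-algebra map `R[t]/(t^p - x^m u) → R[s]/(s^p - x u^β)` (both are models of the same
degree-`p` purely inseparable field `K₀(a^{1/p})`; the new radicand `x u^β = a^β (x^α)^p` lies in the Frobenius
class of `a`), and the target is regular at every prime over a prime `𝔮 ∋ x` of `R` at which `x` is transversal
(`D x ∉ 𝔮` for some derivation `D`) — the landed pointwise transversal theorem applied to `x u^β`. -/

/-- Units arithmetic for the twist. -/
theorem units_zpow_key {R : Type*} [CommRing R] (p m : ℕ) (u : Rˣ) (α β : ℤ)
    (hbez : α * (p : ℤ) + β * (m : ℤ) = 1) :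
    ((u ^ β : Rˣ) : R) ^ m * (((u ^ α : Rˣ) : R)) ^ p = (u : R) := by
  have h : (u ^ β) ^ (m : ℤ) * (u ^ α) ^ (p : ℤ) = u := by
    rw [← zpow_mul, ← zpow_mul, ← zpow_add]
    have : β * (m : ℤ) + α * (p : ℤ) = 1 := by linarith
    rw [this, zpow_one]
  have h' : ((u ^ β) ^ m * (u ^ α) ^ p : Rˣ) = u := by
    exact_mod_cast h
  have := congrArg (fun w : Rˣ => (w : R)) h'
  simpa [Units.val_mul, Units.val_pow_eq_pow_val] using this

/-- Kummer twist: the `R`-algebra map `R[t]/(t^p - x^m u) → R[s]/(s^p - x u^β)`, `t ↦ s^m u^α`,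
for `α p + β m = 1` (PROVED). -/
theorem exists_kummerTwist {R : Type*} [CommRing R] (p m : ℕ) (x : R) (u : Rˣ) (α β : ℤ)
    (hbez : α * (p : ℤ) + β * (m : ℤ) = 1) :
    ∃ φ : AdjoinRoot ((X : R[X]) ^ p - C (x ^ m * (u : R))) →ₐ[R]
        AdjoinRoot ((X : R[X]) ^ p - C (x * ((u ^ β : Rˣ) : R))),
      φ (AdjoinRoot.root _) =
        AdjoinRoot.root ((X : R[X]) ^ p - C (x * ((u ^ β : Rˣ) : R))) ^ m *
          algebraMap R _ ((u ^ α : Rˣ) : R) := by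
  set g : R[X] := (X : R[X]) ^ p - C (x * ((u ^ β : Rˣ) : R)) with hg
  set s : AdjoinRoot g := AdjoinRoot.root g with hs
  have hsp : s ^ p = algebraMap R _ (x * ((u ^ β : Rˣ) : R)) := by
    have h0 : aeval s g = 0 := by rw [hs]; exact AdjoinRoot.aeval_eq g ▸ AdjoinRoot.mk_self
    simp only [hg, map_sub, map_pow, aeval_X, aeval_C] at h0
    exact sub_eq_zero.mp h0
  set r : AdjoinRoot g := s ^ m * algebraMap R _ ((u ^ α : Rˣ) : R) with hr
  have hkey : (x * ((u ^ β : Rˣ) : R)) ^ m * (((u ^ α : Rˣ) : R)) ^ p = x ^ m * (u : R) := by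
    rw [mul_pow, mul_assoc, units_zpow_key p m u α β hbez]
  have hroot : ((X : R[X]) ^ p - C (x ^ m * (u : R))).eval₂ (Algebra.ofId R (AdjoinRoot g)) r = 0 := by
    change aeval r ((X : R[X]) ^ p - C (x ^ m * (u : R))) = 0
    simp only [map_sub, map_pow, aeval_X, aeval_C]
    rw [sub_eq_zero, hr, mul_pow, ← pow_mul, mul_comm m p, pow_mul, hsp, ← map_pow, ← map_pow,
      ← map_mul, hkey]
  refine ⟨AdjoinRoot.liftAlgHom _ (Algebra.ofId R _) r hroot, ?_⟩
  rw [AdjoinRoot.liftAlgHom_root]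

/-- Pointwise regularity of the twisted model over the transversal locus of `x`: if `x ∈ 𝔮 = P ∩ R` and some
derivation `D` of `R` has `D x ∉ 𝔮`, then `R[s]/(s^p - x v)` is regular at `P` for every unit `v`
(here `v = u^β`). [uses `isRegularLocalRing_localModel_of_derivation`] -/
theorem isRegularLocalRing_kummerTwist_of_derivation {R : Type*} [CommRing R] [IsRegularRing R]
    (p : ℕ) (x : R) (v : Rˣ) (D : Derivation ℤ R R)
    (P : Ideal (AdjoinRoot ((X : R[X]) ^ p - C (x * (v : R))))) [P.IsPrime]
    (hx : x ∈ P.comap (AdjoinRoot.of ((X : R[X]) ^ p - C (x * (v : R)))))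
    (hD : D x ∉ P.comap (AdjoinRoot.of ((X : R[X]) ^ p - C (x * (v : R))))) :
    IsRegularLocalRing (Localization.AtPrime P) := by
  refine Summit.ResolutionOfSingularities.ResolutionOfSingularities.Theorems.isRegularLocalRing_localModel_of_derivation
    D (x * (v : R)) p P ?_
  intro hmem
  apply hD
  have hq : (P.comap (AdjoinRoot.of ((X : R[X]) ^ p - C (x * (v : R))))).IsPrime := Ideal.comap_isPrime _ _
  rw [Derivation.leibniz] at hmem
  -- hmem : x • D v + (v : R) • D x ∈ 𝔮
  have hx' : x • D (v : R) ∈ P.comap (AdjoinRoot.of ((X : R[X]) ^ p - C (x * (v : R)))) := by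
    rw [smul_eq_mul]
    exact Ideal.mul_mem_right _ _ hx
  have hv : (v : R) • D x ∈ P.comap (AdjoinRoot.of ((X : R[X]) ^ p - C (x * (v : R)))) := by
    have := Ideal.sub_mem _ hmem hx'
    simpa using this
  rw [smul_eq_mul] at hv
  rcases hq.mem_or_mem hv with h | h
  · exact (hq.ne_top (Ideal.eq_top_of_isUnit_mem _ h (Units.isUnit v))).elim
  · exact h

/-! ## Card `isolated-core-by-function-fields` — first lemma: Giraud's normal form is free in codimension one

In a discrete valuation ring `O` of characteristic `p` (uniformizer `ϖ`, residue field possibly IMPERFECT),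
every `a` whose Frobenius class is `ϖ`-adically separated from the `p`-th powers (automatic when `O` is
excellent and `a ∉ O^p` — this is where the crux's `FiniteType` is used, cf. Disproof
`crux_false_without_finiteType` / F. K. Schmidt's DVR) has a representative `a - b^p = ϖ^m · u` with
EITHER `p ∤ m` (Kummer/toric exit) OR `ū ∉ κ^p` (wound exit). Hence the "bad locus" of Giraud's normal form
problem has codimension ≥ 2 on every regular base, over every ground field. -/

/-- DVR dichotomy for the Frobenius class of `a`. -/
theorem exists_sub_pow_eq_mul_unit_dichotomy {O : Type*} [CommRing O] [IsDomain O]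
    [IsDiscreteValuationRing O] {p : ℕ} (hp : p.Prime) [CharP O p] (ϖ : O) (hϖ : Irreducible ϖ) {a : O}
    (hsep : ∃ N : ℕ, ∀ b : O, ¬ ϖ ^ N ∣ a - b ^ p) :
    ∃ (b : O) (m : ℕ) (u : Oˣ), a - b ^ p = ϖ ^ m * (u : O) ∧
      (¬ p ∣ m ∨ ∀ c : O, ¬ ϖ ∣ (u : O) - c ^ p) := by
  sorry

/-- The ladder lemma behind the card (structural; statement only): writing `LocalModelRing p a` for the
coordinate ring of the reduced local model, if the crux holds for all regular finite-type domains of Krull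
dimension ≤ `d` over ALL fields of characteristic `p`, then for an instance of dimension ≤ `d + 1` the local
model has a resolution after localising `R` at any element-avoiding multiplicative set coming from a
transcendental element — rendered here in the simplest form: localisation of the base at the powers of… is
NOT what we need; we record instead the field-extension form used in NOTES (informal), and only type-check the
dimension-bounded crux predicate. -/
def CruxUpToDim (p d : ℕ) : Prop :=
  ∀ (k : Type) [Field k] [CharP k p] (R : Type) [CommRing R] [IsDomain R] [Algebra k R],
    Algebra.FiniteType k R → IsRegularRing R → ringKrullDim R ≤ d → ∀ a : R,
      Literature.AlgebraicGeometry.Resolution.Scheme.HasResolution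
        (AlgebraicGeometry.Spec (.of (AdjoinRoot ((X : R[X]) ^ p - C a) ⧸
          nilradical (AdjoinRoot ((X : R[X]) ^ p - C a)))))

/-- The crux is the conjunction of its dimension-bounded forms. [folklore] -/
theorem picoverLocalModel_iff_forall_cruxUpToDim :
    Summit.ResolutionOfSingularities.ResolutionOfSingularities.Theses.PAlteration.PicoverLocalModel ↔
      ∀ p : ℕ, p.Prime → ∀ d : ℕ, CruxUpToDim p d := by
  sorry

end Summit.ResolutionOfSingularities.ResolutionOfSingularities.Cruxes.PicoverLocalModel.SketchIdeator3
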